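import Summits.HubbardSuperconductivity.HubbardSuperconductivity.Theorems.WeakCouplingBCSKlBlaschkeTransplant

/-!
KL-MARGIN-SCAN · reader idea-2 (lens «control») · round 5 — `Theorems/WeakCouplingBCSKlBlaschkeTransplantMap.lean`
(helper, supports stmt-HubbardSuperconductivity-0158) — PART B of a pure three-file cut of the x-read prestage
91f4b14c7a1eabde (crit-1 KL STATUS l.10099; p1 pre-flight l.10122); PART A = `…Theorems/WeakCouplingBCSKlBlaschkeTransplant.lean`
(§0–§1: `klS klA klMuT klC mobius`, the exact factorisation, `level_iff_mobius`); PART C =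
`…Theorems/WeakCouplingBCSKlBlaschkeTransplantTargets.lean` (§4, imports this file).  No statement changed (docstrings added); 0 sorry.
  §2 β_a(k) = k − 2·arctan(a sin k/(1 + a cos k)) (boundary phase of the Blaschke factor (z + a)/(1 + a z), A = 2a/(1+a²)):
     cos β_a = T_A ∘ cos, sin β_a = (1 − a²) sin k/(1 + a² + 2a cos k), β_a′ = (1 − a²)/(1 + a² + 2a cos k) > 0 (Poisson
     kernel = Jacobian), β_{−a} ∘ β_a = id, β_a a bijection of [−π, π);
  §3 Φ_a := β_a × β_a: D₄-equivariant bijection of the Brillouin zone transporting channels and Fermi curves,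
     ε_{t′}(k) = μ ⟺ ε₀(Φ_a k) = μ̃,  Φ_a '' fermiCurve(ε_{t′}, μ) = fermiCurve(ε₀, μ̃);  density identity
     C(1 + A cos k₀)(1 + A cos k₁)·β_a′(k₀)·β_a′(k₁) = s (constant);
  (§4, the typed targets T1–T3 and `channelOrder_of_transplant`, is PART C.)
Honest framing: nothing here is a statement about superconductivity; a Kohn–Luttinger statement is not ODLRO;
no margin, window, U₀ or K₃ claim is made.
-/

set_option linter.dupNamespace false
set_option linter.style.longLine false

noncomputable section

namespace Summit.HubbardSuperconductivity.HubbardSuperconductivity.Theorems.KlBlaschkeTransplant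

open Real MeasureTheory Literature.MathematicalPhysics.QuantumLattice

variable {tp μ a : ℝ}

/-! ### §2 The Blaschke boundary phase `β_a` -/

/-- `β_a(k) = k − 2·arctan(a sin k / (1 + a cos k))` = `arg((e^{ik} + a)/(1 + a e^{ik}))`. -/
def blaschkeAngle (a k : ℝ) : ℝ := k - 2 * arctan (a * sin k / (1 + a * cos k))

/-- `1 + a cos k > 0` for `|a| < 1` (the arctangent argument of `β_a` is well defined). -/
theorem one_add_mul_cos_pos (ha : |a| < 1) (k : ℝ) : 0 < 1 + a * cos k :=
  one_add_mul_pos ha (abs_cos_le_one k)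

/-- The Poisson denominator `1 + a² + 2a cos k = |1 + a e^{ik}|² > 0`. -/
theorem poisson_den_pos (ha : |a| < 1) (k : ℝ) : 0 < 1 + a ^ 2 + 2 * a * cos k := by
  have h1 : |a * cos k| ≤ |a| := by
    rw [abs_mul]; exact mul_le_of_le_one_right (abs_nonneg _) (abs_cos_le_one k)
  have h2 := neg_abs_le (a * cos k)
  have h3 : 0 < (1 - |a|) ^ 2 := by
    have : 0 < 1 - |a| := by linarith
    positivity
  nlinarith [sq_abs a]

/-- `(1 + a cos k)² + (a sin k)² = 1 + a² + 2a cos k`. -/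
theorem poisson_aux (a k : ℝ) : (1 + a * cos k) ^ 2 + (a * sin k) ^ 2 = 1 + a ^ 2 + 2 * a * cos k := by
  linear_combination a ^ 2 * sin_sq_add_cos_sq k

/-- `1 + u²` for `u = a sin k/(1 + a cos k)`, as a quotient by `(1 + a cos k)²`. -/
theorem one_add_blaschkeU_sq (ha : |a| < 1) (k : ℝ) :
    1 + (a * sin k / (1 + a * cos k)) ^ 2 = (1 + a ^ 2 + 2 * a * cos k) / (1 + a * cos k) ^ 2 := by
  rw [div_pow, one_add_div (pow_ne_zero 2 (one_add_mul_cos_pos ha k).ne'), poisson_aux]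

/-- Two pure rational identities (atoms universally quantified, so that `field` clears them). -/
theorem rat_aux_cos (c s a E D : ℝ) (_hE : E ≠ 0) (_hD : D ≠ 0) :
    c * (2 / (D / E ^ 2) - 1) + s * (2 * (a * s / E) / (D / E ^ 2))
      = (c * (2 * E ^ 2 - D) + 2 * a * s ^ 2 * E) / D := by
  field

/-- Companion rational identity for the sine of `β_a` (atoms universally quantified). -/
theorem rat_aux_sin (c s a E D : ℝ) (_hE : E ≠ 0) (_hD : D ≠ 0) :
    s * (2 / (D / E ^ 2) - 1) - c * (2 * (a * s / E) / (D / E ^ 2))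
      = (s * (2 * E ^ 2 - D) - 2 * a * c * s * E) / D := by
  field

/-- `cos(2 arctan u) = 2/(1 + u²) − 1`. -/
theorem cos_two_arctan (u : ℝ) : cos (2 * arctan u) = 2 / (1 + u ^ 2) - 1 := by
  have hu2 : 0 < 1 + u ^ 2 := by positivity
  rw [cos_two_mul, cos_arctan, div_pow, one_pow, Real.sq_sqrt hu2.le, mul_one_div]

/-- `sin(2 arctan u) = 2u/(1 + u²)`. -/
theorem sin_two_arctan (u : ℝ) : sin (2 * arctan u) = 2 * u / (1 + u ^ 2) := by
  have hu2 : 0 < 1 + u ^ 2 := by positivity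
  rw [sin_two_mul, sin_arctan, cos_arctan, mul_assoc, div_mul_div_comm, mul_one, Real.mul_self_sqrt hu2.le]
  ring

/-- `cos β_a(k) = ((1 + a²) cos k + 2a)/(1 + a² + 2a cos k)`. -/
theorem cos_blaschkeAngle (ha : |a| < 1) (k : ℝ) :
    cos (blaschkeAngle a k) = ((1 + a ^ 2) * cos k + 2 * a) / (1 + a ^ 2 + 2 * a * cos k) := by
  have hc : (1 + a * cos k) ≠ 0 := (one_add_mul_cos_pos ha k).ne'
  have hD : 1 + a ^ 2 + 2 * a * cos k ≠ 0 := (poisson_den_pos ha k).ne'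
  unfold blaschkeAngle
  rw [cos_sub, cos_two_arctan, sin_two_arctan, one_add_blaschkeU_sq ha, rat_aux_cos _ _ _ _ _ hc hD]
  congr 1
  linear_combination (2 * a + 2 * a ^ 2 * cos k) * sin_sq_add_cos_sq k

/-- `sin β_a(k) = (1 − a²) sin k/(1 + a² + 2a cos k)`. -/
theorem sin_blaschkeAngle (ha : |a| < 1) (k : ℝ) :
    sin (blaschkeAngle a k) = (1 - a ^ 2) * sin k / (1 + a ^ 2 + 2 * a * cos k) := by
  have hc : (1 + a * cos k) ≠ 0 := (one_add_mul_cos_pos ha k).ne'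
  have hD : 1 + a ^ 2 + 2 * a * cos k ≠ 0 := (poisson_den_pos ha k).ne'
  unfold blaschkeAngle
  rw [sin_sub, cos_two_arctan, sin_two_arctan, one_add_blaschkeU_sq ha, rat_aux_sin _ _ _ _ _ hc hD]
  congr 1
  ring

/-- `cos β_a = T_A ∘ cos` with `A = 2a/(1 + a²)`. -/
theorem cos_blaschkeAngle_mobius (ha : |a| < 1) (k : ℝ) :
    cos (blaschkeAngle a k) = mobius (2 * a / (1 + a ^ 2)) (cos k) := by
  rw [cos_blaschkeAngle ha]
  unfold mobius
  have h1 : (1:ℝ) + a ^ 2 ≠ 0 := by positivity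
  generalize (1:ℝ) + a ^ 2 = P at *
  rw [show cos k + 2 * a / P = (P * cos k + 2 * a) / P by field,
    show 1 + 2 * a / P * cos k = (P + 2 * a * cos k) / P by field,
    div_div_div_cancel_right₀ h1]

/-- **The Poisson kernel is the Jacobian**: `β_a′(k) = (1 − a²)/(1 + a² + 2a cos k)`. -/
theorem hasDerivAt_blaschkeAngle (ha : |a| < 1) (k : ℝ) :
    HasDerivAt (blaschkeAngle a) ((1 - a ^ 2) / (1 + a ^ 2 + 2 * a * cos k)) k := by
  have hc : 0 < 1 + a * cos k := one_add_mul_cos_pos ha k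
  have hD := (poisson_den_pos ha k).ne'
  have hc' := hc.ne'
  have hF : a * cos k * (1 + a * cos k) - a * sin k * (a * -sin k) = a * (a + cos k) := by
    linear_combination a ^ 2 * sin_sq_add_cos_sq k
  have h1 : HasDerivAt (fun x => a * sin x / (1 + a * cos x))
      ((a * cos k * (1 + a * cos k) - a * sin k * (a * -sin k)) / (1 + a * cos k) ^ 2) k := by
    have hn : HasDerivAt (fun x => a * sin x) (a * cos k) k := (hasDerivAt_sin k).const_mul a
    have hd : HasDerivAt (fun x => 1 + a * cos x) (a * -sin k) k :=
      ((hasDerivAt_cos k).const_mul a).const_add 1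
    exact hn.div hd hc'
  have h2 : HasDerivAt (fun x => arctan (a * sin x / (1 + a * cos x)))
      (1 / (1 + (a * sin k / (1 + a * cos k)) ^ 2)
        * ((a * cos k * (1 + a * cos k) - a * sin k * (a * -sin k)) / (1 + a * cos k) ^ 2)) k := h1.arctan
  have key : (1:ℝ) - 2 * (1 / (1 + (a * sin k / (1 + a * cos k)) ^ 2)
        * ((a * cos k * (1 + a * cos k) - a * sin k * (a * -sin k)) / (1 + a * cos k) ^ 2))
      = (1 - a ^ 2) / (1 + a ^ 2 + 2 * a * cos k) := by
    rw [hF, div_pow, show 1 + (a * sin k) ^ 2 / (1 + a * cos k) ^ 2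
        = ((1 + a * cos k) ^ 2 + (a * sin k) ^ 2) / (1 + a * cos k) ^ 2 by
          rw [add_div, div_self (pow_ne_zero 2 hc')], poisson_aux]
    field_simp
    ring
  rw [← key]
  exact (hasDerivAt_id' k).sub (h2.const_mul 2)

/-- The Jacobian `β_a′(k) = (1 − a²)/(1 + a² + 2a cos k)` (Poisson kernel) is positive. -/
theorem blaschkeAngle_deriv_pos (ha : |a| < 1) (k : ℝ) : 0 < (1 - a ^ 2) / (1 + a ^ 2 + 2 * a * cos k) :=
  div_pos (Literature.Analysis.SpecialFunctions.one_sub_sq_pos_of_abs_lt_one ha) (poisson_den_pos ha k)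

/-- `β_a` is strictly increasing on `ℝ` for `|a| < 1`. -/
theorem blaschkeAngle_strictMono (ha : |a| < 1) : StrictMono (blaschkeAngle a) :=
  strictMono_of_deriv_pos fun k => by
    rw [(hasDerivAt_blaschkeAngle ha k).deriv]; exact blaschkeAngle_deriv_pos ha k

/-- `β_a` is continuous for `|a| < 1`. -/
theorem blaschkeAngle_continuous (ha : |a| < 1) : Continuous (blaschkeAngle a) :=
  continuous_iff_continuousAt.2 fun k => (hasDerivAt_blaschkeAngle ha k).continuousAt

/-- `β_a` is odd: `β_a(−k) = −β_a(k)`. -/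
theorem blaschkeAngle_neg (a k : ℝ) : blaschkeAngle a (-k) = -blaschkeAngle a k := by
  simp only [blaschkeAngle, sin_neg, cos_neg, mul_neg, neg_div, arctan_neg]
  ring

/-- `β_a(k + 2π) = β_a(k) + 2π` (a lift of a degree-one circle map). -/
theorem blaschkeAngle_add_two_pi (a k : ℝ) : blaschkeAngle a (k + 2 * π) = blaschkeAngle a k + 2 * π := by
  simp only [blaschkeAngle, sin_add_two_pi, cos_add_two_pi]
  ring

/-- `β_a(0) = 0`. -/
theorem blaschkeAngle_zero (a : ℝ) : blaschkeAngle a 0 = 0 := by simp [blaschkeAngle]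

/-- `β_a(π) = π`. -/
theorem blaschkeAngle_pi (a : ℝ) : blaschkeAngle a π = π := by simp [blaschkeAngle]

/-- `β_a(−π) = −π`. -/
theorem blaschkeAngle_neg_pi (a : ℝ) : blaschkeAngle a (-π) = -π := by
  rw [blaschkeAngle_neg, blaschkeAngle_pi]

/-- `β_{−a}` inverts `β_a` (the inverse Blaschke factor). -/
theorem blaschkeAngle_inv (ha : |a| < 1) (k : ℝ) : blaschkeAngle (-a) (blaschkeAngle a k) = k := by
  have hc : (1 + a * cos k) ≠ 0 := (one_add_mul_cos_pos ha k).ne'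
  have hD : 1 + a ^ 2 + 2 * a * cos k ≠ 0 := (poisson_den_pos ha k).ne'
  have hW : 1 - a ^ 2 ≠ 0 := (Literature.Analysis.SpecialFunctions.one_sub_sq_pos_of_abs_lt_one ha).ne'
  have key : -a * sin (blaschkeAngle a k) / (1 + -a * cos (blaschkeAngle a k))
      = -(a * sin k / (1 + a * cos k)) := by
    rw [sin_blaschkeAngle ha, cos_blaschkeAngle ha]
    have hnum : 1 + a ^ 2 + 2 * a * cos k - a * ((1 + a ^ 2) * cos k + 2 * a)
        = (1 - a ^ 2) * (1 + a * cos k) := by ring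
    generalize 1 + a ^ 2 + 2 * a * cos k = D at *
    generalize 1 - a ^ 2 = W at *
    generalize 1 + a * cos k = E at *
    rw [show 1 + -a * (((1 + a ^ 2) * cos k + 2 * a) / D) = (D - a * ((1 + a ^ 2) * cos k + 2 * a)) / D by field,
      hnum]
    field
  rw [show blaschkeAngle (-a) (blaschkeAngle a k)
      = blaschkeAngle a k - 2 * arctan (-a * sin (blaschkeAngle a k) / (1 + -a * cos (blaschkeAngle a k))) from rfl,
    key, arctan_neg]
  unfold blaschkeAngle
  ring

/-- `β_a` maps the fundamental interval `[−π, π)` into itself. -/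
theorem blaschkeAngle_mapsTo (ha : |a| < 1) :
    Set.MapsTo (blaschkeAngle a) (Set.Ico (-π) π) (Set.Ico (-π) π) := by
  intro k hk
  have hm := blaschkeAngle_strictMono ha
  refine ⟨?_, ?_⟩
  · have := hm.monotone hk.1
    rwa [blaschkeAngle_neg_pi] at this
  · have := hm hk.2
    rwa [blaschkeAngle_pi] at this

/-- `β_a` is a bijection of `[−π, π)` with inverse `β_{−a}`. -/
theorem blaschkeAngle_bijOn (ha : |a| < 1) :
    Set.BijOn (blaschkeAngle a) (Set.Ico (-π) π) (Set.Ico (-π) π) := by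
  have ha' : |-a| < 1 := by rwa [abs_neg]
  refine Set.InvOn.bijOn (f' := blaschkeAngle (-a)) ⟨?_, ?_⟩ (blaschkeAngle_mapsTo ha) (blaschkeAngle_mapsTo ha')
  · intro k _
    exact blaschkeAngle_inv ha k
  · intro k _
    simpa using blaschkeAngle_inv ha' k

/-! ### §3 The transplant map `Φ_a = β_a × β_a` on momentum space -/

/-- `Φ_a(k₀, k₁) = (β_a k₀, β_a k₁)`. -/
def blaschkeMap (a : ℝ) (k : Momentum) : Momentum :=
  WithLp.toLp 2 ![blaschkeAngle a (k 0), blaschkeAngle a (k 1)]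

/-- First coordinate of `Φ_a k` is `β_a(k₀)`. -/
@[simp] theorem blaschkeMap_apply_zero (a : ℝ) (k : Momentum) :
    blaschkeMap a k 0 = blaschkeAngle a (k 0) := by simp [blaschkeMap]

/-- Second coordinate of `Φ_a k` is `β_a(k₁)`. -/
@[simp] theorem blaschkeMap_apply_one (a : ℝ) (k : Momentum) :
    blaschkeMap a k 1 = blaschkeAngle a (k 1) := by simp [blaschkeMap]

/-- `Φ_{−a} ∘ Φ_a = id`. -/
theorem blaschkeMap_inv (ha : |a| < 1) (k : Momentum) : blaschkeMap (-a) (blaschkeMap a k) = k := by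
  ext i
  fin_cases i <;> simp [blaschkeAngle_inv ha]

/-- `Φ_a ∘ Φ_{−a} = id`. -/
theorem blaschkeMap_inv' (ha : |a| < 1) (q : Momentum) : blaschkeMap a (blaschkeMap (-a) q) = q := by
  have ha' : |-a| < 1 := by rwa [abs_neg]
  simpa using blaschkeMap_inv ha' q

/-- `Φ_a` maps the Brillouin zone `[−π, π)²` into itself. -/
theorem blaschkeMap_mapsTo (ha : |a| < 1) : Set.MapsTo (blaschkeMap a) brillouinZone brillouinZone := by
  intro k hk i
  fin_cases i
  · simpa using blaschkeAngle_mapsTo ha (hk 0)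
  · simpa using blaschkeAngle_mapsTo ha (hk 1)

/-- `Φ_a` is a bijection of the Brillouin zone `[−π, π)²` with inverse `Φ_{−a}`. -/
theorem blaschkeMap_bijOn (ha : |a| < 1) : Set.BijOn (blaschkeMap a) brillouinZone brillouinZone := by
  have ha' : |-a| < 1 := by rwa [abs_neg]
  refine Set.InvOn.bijOn (f' := blaschkeMap (-a)) ⟨?_, ?_⟩ (blaschkeMap_mapsTo ha) (blaschkeMap_mapsTo ha')
  · intro k _
    exact blaschkeMap_inv ha k
  · intro q _
    exact blaschkeMap_inv' ha q

/-- `Φ_a` commutes with the rotation generator of `D₄` on momentum space. -/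
theorem blaschkeMap_rot (a : ℝ) (k : Momentum) :
    blaschkeMap a (rotMomentum k) = rotMomentum (blaschkeMap a k) := by
  ext i
  fin_cases i <;> simp [blaschkeMap, rotMomentum, blaschkeAngle_neg]

/-- `Φ_a` commutes with the reflection generator of `D₄` on momentum space. -/
theorem blaschkeMap_refl (a : ℝ) (k : Momentum) :
    blaschkeMap a (reflMomentum k) = reflMomentum (blaschkeMap a k) := by
  ext i
  fin_cases i <;> simp [blaschkeMap, reflMomentum, blaschkeAngle_neg]

/-- **D₄-equivariance** of `Φ_a`. -/
theorem blaschkeMap_d4 (a : ℝ) (g : DihedralGroup 4) (k : Momentum) :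
    blaschkeMap a (d4Momentum g k) = d4Momentum g (blaschkeMap a k) := by
  have hc : Function.Commute (blaschkeMap a) rotMomentum := fun k => blaschkeMap_rot a k
  cases g with
  | r i =>
    simp only [d4Momentum]
    exact (hc.iterate_right i.val) k
  | sr i =>
    simp only [d4Momentum]
    rw [blaschkeMap_refl, (hc.iterate_right i.val) k]

/-- `Φ_a` transports symmetry channels: `ψ ∈ χ ⇒ ψ ∘ Φ_a ∈ χ`. -/
theorem inChannel_comp_blaschkeMap (a : ℝ) {χ : D4Irrep} {ψ : Momentum → ℝ} (h : InChannel χ ψ) :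
    InChannel χ (ψ ∘ blaschkeMap a) := by
  unfold InChannel at h ⊢
  funext k
  have hk := congrFun h (blaschkeMap a k)
  simp only [d4Project, Function.comp_apply, blaschkeMap_d4] at hk ⊢
  exact hk

/-- `ε₀ ∘ Φ_a = −2(T_A(cos k₀) + T_A(cos k₁))`, `A = 2a/(1 + a²)`. -/
theorem squareDispersion_zero_blaschkeMap (ha : |a| < 1) (k : Momentum) :
    squareDispersion 1 0 (blaschkeMap a k)
      = -2 * (mobius (2 * a / (1 + a ^ 2)) (cos (k 0)) + mobius (2 * a / (1 + a ^ 2)) (cos (k 1))) := by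
  simp only [squareDispersion, blaschkeMap_apply_zero, blaschkeMap_apply_one, cos_blaschkeAngle_mobius ha]
  ring

/-- For every admissible `A` there is a Blaschke parameter `a ∈ (−1, 1)` with `2a/(1 + a²) = A`
(namely `a = A/(1 + √(1 − A²))`). -/
theorem exists_blaschke_param {A : ℝ} (hA : |A| < 1) : ∃ a : ℝ, |a| < 1 ∧ 2 * a / (1 + a ^ 2) = A := by
  have h1 : 0 < 1 - A ^ 2 := Literature.Analysis.SpecialFunctions.one_sub_sq_pos_of_abs_lt_one hA
  obtain ⟨r, hr_def⟩ : ∃ r, r = Real.sqrt (1 - A ^ 2) := ⟨_, rfl⟩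
  have hr : r ^ 2 = 1 - A ^ 2 := by rw [hr_def]; exact Real.sq_sqrt h1.le
  have hr0 : 0 < r := by rw [hr_def]; exact Real.sqrt_pos.2 h1
  have h1r : (1:ℝ) + r ≠ 0 := by linarith
  refine ⟨A / (1 + r), ?_, ?_⟩
  · rw [abs_div, abs_of_pos (by linarith : (0:ℝ) < 1 + r), div_lt_one (by linarith)]
    linarith
  · have e1 : 1 + (A / (1 + r)) ^ 2 = 2 / (1 + r) := by
      rw [div_pow, one_add_div (pow_ne_zero 2 h1r), div_eq_div_iff (pow_ne_zero 2 h1r) h1r]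
      linear_combination (1 + r) * hr
    rw [e1, div_div_eq_mul_div, div_eq_iff (two_ne_zero)]
    field_simp

/-- **Level transplant**: `ε_{t′}(k) = μ ⟺ ε₀(Φ_a k) = μ̃` whenever `2a/(1 + a²) = A(t′, μ)`. -/
theorem level_transplant (htp : |tp| < 1 / 2) (hμ : tp * μ < 1) (ha : |a| < 1)
    (hA : 2 * a / (1 + a ^ 2) = klA tp μ) (k : Momentum) :
    squareDispersion 1 tp k = μ ↔ squareDispersion 1 0 (blaschkeMap a k) = klMuT tp μ := by
  rw [level_iff_mobius htp hμ k, squareDispersion_zero_blaschkeMap ha, hA]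

/-- **Fermi-curve transplant**: `Φ_a` maps the t–t′ Fermi curve at `μ` ONTO the NN Fermi curve at `μ̃`. -/
theorem image_fermiCurve (htp : |tp| < 1 / 2) (hμ : tp * μ < 1) (ha : |a| < 1)
    (hA : 2 * a / (1 + a ^ 2) = klA tp μ) :
    blaschkeMap a '' fermiCurve (squareDispersion 1 tp) μ = fermiCurve (squareDispersion 1 0) (klMuT tp μ) := by
  have ha' : |-a| < 1 := by rwa [abs_neg]
  ext q
  constructor
  · rintro ⟨k, hk, rfl⟩
    exact ⟨blaschkeMap_mapsTo ha hk.1, (level_transplant htp hμ ha hA k).1 hk.2⟩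
  · intro hq
    refine ⟨blaschkeMap (-a) q, ⟨blaschkeMap_mapsTo ha' hq.1, ?_⟩, blaschkeMap_inv' ha q⟩
    rw [level_transplant htp hμ ha hA, blaschkeMap_inv' ha q]
    exact hq.2

/-- The 1D Jacobian cancels the Möbius weight: `(1 + A cos k)·β_a′(k) = (1 − a²)/(1 + a²)` (constant in `k`). -/
theorem jacobian_cancel (ha : |a| < 1) (c : ℝ) (hc : |c| ≤ 1) :
    (1 + 2 * a / (1 + a ^ 2) * c) * ((1 - a ^ 2) / (1 + a ^ 2 + 2 * a * c)) = (1 - a ^ 2) / (1 + a ^ 2) := by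
  have h1 : (1:ℝ) + a ^ 2 ≠ 0 := by positivity
  have h2 : 1 + a ^ 2 + 2 * a * c ≠ 0 := by
    have h1' : |a * c| ≤ |a| := by
      rw [abs_mul]; exact mul_le_of_le_one_right (abs_nonneg _) hc
    have h2' := neg_abs_le (a * c)
    have h3 : 0 < (1 - |a|) ^ 2 := by
      have : 0 < 1 - |a| := by linarith
      positivity
    nlinarith [sq_abs a]
  field_simp

/-- `((1 − a²)/(1 + a²))² = 1 − A²` with `A = 2a/(1 + a²)`. -/
theorem one_sub_sq_two_mul_div (a : ℝ) :
    ((1 - a ^ 2) / (1 + a ^ 2)) * ((1 - a ^ 2) / (1 + a ^ 2)) = 1 - (2 * a / (1 + a ^ 2)) ^ 2 := by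
  have h1 : (1:ℝ) + a ^ 2 ≠ 0 := by positivity
  field_simp
  ring

/-- **The density identity** (heart of the measure isomorphism T1): on the whole torus,
`C·(1 + A cos k₀)β_a′(k₀)·(1 + A cos k₁)β_a′(k₁) = s`, a constant. -/
theorem transplant_density_const (htp : |tp| < 1 / 2) (hμ : tp * μ < 1) (ha : |a| < 1)
    (hA : 2 * a / (1 + a ^ 2) = klA tp μ) (c₀ c₁ : ℝ) (h₀ : |c₀| ≤ 1) (h₁ : |c₁| ≤ 1) :
    klC tp μ * ((1 + klA tp μ * c₀) * ((1 - a ^ 2) / (1 + a ^ 2 + 2 * a * c₀)))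
              * ((1 + klA tp μ * c₁) * ((1 - a ^ 2) / (1 + a ^ 2 + 2 * a * c₁))) = klS tp μ := by
  rw [← hA, jacobian_cancel ha c₀ h₀, jacobian_cancel ha c₁ h₁, mul_assoc, one_sub_sq_two_mul_div, hA]
  exact klC_mul_one_sub_sq htp hμ

end Summit.HubbardSuperconductivity.HubbardSuperconductivity.Theorems.KlBlaschkeTransplant

end
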